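import Summits.RiemannHypothesis.RiemannHypothesis.Theorems.PfPersistenceBottomSpace
import Summits.RiemannHypothesis.RiemannHypothesis.Theorems.PfPersistenceEigenvectorTolerance
import HarnessLib

/-!
# PF persistence — the BINDER-FREE eigenvector-tolerance wall: the eigenspace-tolerance class, its robustness at
`ζ` with no hypothesis, and the bridges to the gen-3 binder (pub-rhpf, barrier-prover gen 4; file 2 of 2)

**HONEST FRAMING. This is a long-odds MECHANISM SEARCH; no RH claims.** Everything in this file is RH-free: the
linear algebra of `PfPersistenceBottomSpace` plus the cell's dichotomy-carried relative W2 wall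
(`not_separates_of_robustWithin_arith`, itself RH-free: it CASES on the tally dichotomy, it does not decide it).
Nothing here bears on the truth of RH. Labels: every statement below is PROVED; no DATA.

WHAT THIS FILE CHANGES. The gen-3 wall `not_separates_of_evToleranceClass_subset` carries, at each of its finitely
many windows, the NUMERICAL BINDER `HasBottomGap (zetaDatum (W i)) (U₀ i) (γ i)` (certified simple bottom + gap of
`ζ`'s model matrix); leaf G1.22ev therefore stood 'closed-by-theorem MODULO per-window binders' (RULINGS A186 /
A195). Here the binder is REMOVED for the tolerance face:

* §6 the EIGENSPACE-TOLERANCE CLASS `esToleranceClass d₀ W τ` (data whose bottom vectors at the windows `W i` exist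
  and all lie within `τ` of the reference's bottom EIGENSPACES, `NearSpace τ`), its scale invariance, its robustness
  at ANY dial-space reference WITH NO BINDER (`robustWithin_dialSpace_esToleranceClass`: space gaps exist by
  `exists_spaceGap_of_isSymm`, tolerance by the eigenspace Davis–Kahan lemma), and the wall
  `not_separates_of_esToleranceClass_subset`: for every finite window list `W`, every `τ > 0`, every
  `S ⊇ esToleranceClass ζ W τ ∩ arithDialSpace` and every `D ⊇ arithDialSpace`, `¬ Separates S D ζ` — hypotheses:
  none beyond `0 < τ`; plus the joint-shape-reader form and the sharing statement.
* §7 BRIDGES to gen 3: `(∃ γ, HasBottomGap M u₀ γ)` ⟺ `u₀` is a bottom vector and the bottom is SIMPLE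
  (`hasBottomGap_iff_simple`) — so the gen-3 binder is exactly 'simple bottom'; at simple windows
  `esToleranceClass = evToleranceClass` (`esToleranceClass_eq_evToleranceClass`), whence the gen-3 wall with 'simple
  bottom' in place of the certified gap (`not_separates_of_evToleranceClass_subset_of_simple`); at degenerate windows
  the eigenspace class is the honest (and closed) reader. NOT removed: the one-signed / shape faces of G1.22ev read a
  bottom VECTOR and keep their margin / cone hypotheses; `τ = 0`, at-threshold and all-window readers stay outside
  (W1 / door E1).
-/

set_option linter.dupNamespace false  -- the mandated namespace repeats `RiemannHypothesis`

noncomputable section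

open Real Finset Matrix Set

namespace Summit.RiemannHypothesis.RiemannHypothesis.Theorems.PfPersistence

/-! ## §6 The eigenspace-tolerance class, its binder-free robustness, and the wall -/

/-- THE EIGENSPACE-TOLERANCE CLASS at the windows `W i` with reference datum `d₀` and tolerance `τ`: data each of
whose window matrices `d (W i)` HAS a bottom vector, ALL of whose bottom vectors lie within `τ` of the reference's
bottom EIGENSPACE `bottomSpace (d₀ (W i))` (`NearSpace τ`). At a window where `d₀`'s bottom is simple this is the
gen-3 class `evToleranceClass` (§7); at a degenerate window it is the honest reader ('the bottom vector lies near
the bottom eigenspace of `ζ`'). [folklore] -/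
def esToleranceClass {k : ℕ} (d₀ : Datum) (W : Fin k → Window) (τ : ℝ) : Set Datum :=
  {d | ∀ i, (∃ u, IsBottomVector (d (W i)) u) ∧
    ∀ u, IsBottomVector (d (W i)) u → NearSpace τ u (bottomSpace (d₀ (W i)))}

/-- PROVED: a dial-space reference lies in its own class for every `τ ≥ 0`. [folklore] -/
theorem mem_esToleranceClass_self {k : ℕ} {d₀ : Datum} (hd₀ : d₀ ∈ dialSpace) (W : Fin k → Window) {τ : ℝ}
    (hτ : 0 ≤ τ) : d₀ ∈ esToleranceClass d₀ W τ := fun i =>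
  ⟨(exists_isBottomVector_of_mem_dialSpace hd₀ (W i)).imp fun _ h => h.1,
    fun _ hu => (nearSpace_zero_of_mem hu.2).mono hτ⟩

/-- PROVED (the A115 'scale-free' word): the eigenspace-tolerance class is SCALE-INVARIANT. [folklore] -/
theorem scaleInvariant_esToleranceClass {k : ℕ} (d₀ : Datum) (W : Fin k → Window) (τ : ℝ) :
    ScaleInvariant (esToleranceClass d₀ W τ) := by
  intro c hc d
  simp only [esToleranceClass, mem_setOf_eq, smul_datum_apply, isBottomVector_smul_iff hc]

/-- PROVED (membership by the eigenspace Davis–Kahan lemma): a datum SYMMETRIC at the windows and `ε`-close to a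
symmetric reference with space gaps `γ i` lies in the class as soon as `2ε/γ i ≤ τ` for every `i`. [folklore] -/
theorem mem_esToleranceClass_of_uniformlyClose {k : ℕ} {W : Fin k → Window} {γ : Fin k → ℝ} {d₀ d : Datum}
    (h₀ : ∀ i, (d₀ (W i)).IsSymm) (hgap : ∀ i, SpaceGap (d₀ (W i)) (γ i)) (hd : ∀ i, (d (W i)).IsSymm)
    {ε τ : ℝ} (hclose : UniformlyClose ε d₀ d) (hτ : ∀ i, 2 * ε / γ i ≤ τ) : d ∈ esToleranceClass d₀ W τ :=
  fun i => ⟨(exists_isBottomVector_of_isSymm (hd i)).imp fun _ h => h.1,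
    fun _ hu => (nearSpace_bottomSpace_of_isBottomVector (h₀ i) (hgap i) (fun v => hclose (W i) v) hu).mono (hτ i)⟩

/-- **PROVED — THE MAIN LEMMA, BINDER-FREE: the eigenspace-tolerance class around ANY dial-space reference is
robust at that reference WITHIN THE DIAL SPACE.** For every `τ > 0` some `τ_unif`-ball around `d₀`, intersected
with `dialSpace`, lies in `esToleranceClass d₀ W τ` (space gaps from `exists_spaceGap_of_isSymm`, bottom vectors
from symmetry, tolerance from the eigenspace Davis–Kahan lemma). No hypothesis on `d₀`'s spectrum. [folklore] -/
theorem robustWithin_dialSpace_esToleranceClass {d₀ : Datum} (hd₀ : d₀ ∈ dialSpace) {k : ℕ} (W : Fin k → Window)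
    {τ : ℝ} (hτ : 0 < τ) : RobustWithin dialSpace (esToleranceClass d₀ W τ) d₀ := by
  choose γ hγ using fun i => exists_spaceGap_of_isSymm (isSymm_of_mem_dialSpace hd₀ (W i))
  obtain ⟨ε, hε, hle⟩ := exists_eps_forall_le (fun i => (hγ i).1) hτ
  exact ⟨ε, hε, fun d hd hc => mem_esToleranceClass_of_uniformlyClose (fun i => isSymm_of_mem_dialSpace hd₀ (W i))
    hγ (fun i => isSymm_of_mem_dialSpace hd (W i)) hc hle⟩

/-- PROVED: the case `d₀ = ζ`. [folklore] -/
theorem robustWithin_dialSpace_esToleranceClass_zeta {k : ℕ} (W : Fin k → Window) {τ : ℝ} (hτ : 0 < τ) :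
    RobustWithin dialSpace (esToleranceClass zetaDatum W τ) zetaDatum :=
  robustWithin_dialSpace_esToleranceClass (arithDialSpace_subset_dialSpace zetaDatum_mem_arithDialSpace) W hτ

/-- **PROVED — THE BINDER-FREE WALL FOR EIGENVECTOR-TOLERANCE CLASSES (`L_k × R0`, leaf G1.22ev, tolerance face),
otherwise UNCONDITIONAL (dichotomy-carried).** For every finite window list `W`, every `τ > 0`, every class `S`
containing the arithmetic part of `esToleranceClass ζ W τ` and every `D ⊇ arithDialSpace`: `S` does not separate
`ζ` from the detectably negative members of `D`. No gap certificate, no simplicity of `ζ`'s bottoms, no `DialReady`,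
no density word. [folklore] -/
theorem not_separates_of_esToleranceClass_subset {k : ℕ} (W : Fin k → Window) {τ : ℝ} (hτ : 0 < τ)
    {S D : Set Datum} (hS : esToleranceClass zetaDatum W τ ∩ arithDialSpace ⊆ S) (hD : arithDialSpace ⊆ D) :
    ¬ Separates S D zetaDatum :=
  not_separates_of_robustWithin_arith hD
    (((robustWithin_dialSpace_esToleranceClass_zeta W hτ).anti arithDialSpace_subset_dialSpace).mono hS)

/-- PROVED (JOINT SHAPE READERS OF THE BOTTOM VECTORS AT `k` WINDOWS, eigenspace form): if a property `P` of a
TUPLE of coefficient vectors holds whenever each entry is nonzero and within `τ` of `ζ`'s bottom eigenspace at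
`W i`, the class lies in `{d | every tuple of bottom vectors has P}` — so such readers inherit the wall. [folklore] -/
theorem esToleranceClass_subset_forall_tuple {k : ℕ} {d₀ : Datum} {W : Fin k → Window} {τ : ℝ}
    {P : ((i : Fin k) → (Fin ((W i).N + 1) → ℝ)) → Prop}
    (hP : ∀ U : (i : Fin k) → (Fin ((W i).N + 1) → ℝ),
      (∀ i, U i ≠ 0 ∧ NearSpace τ (U i) (bottomSpace (d₀ (W i)))) → P U) :
    esToleranceClass d₀ W τ ⊆ {d | ∀ U : (i : Fin k) → (Fin ((W i).N + 1) → ℝ),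
      (∀ i, IsBottomVector (d (W i)) (U i)) → P U} :=
  fun _ hd U hU => hP U fun i => ⟨(hU i).1, (hd i).2 (U i) (hU i)⟩

/-- PROVED: the wall for such joint shape readers. [folklore] -/
theorem not_separates_of_forall_tuple_nearSpace_subset {k : ℕ} (W : Fin k → Window) {τ : ℝ} (hτ : 0 < τ)
    {P : ((i : Fin k) → (Fin ((W i).N + 1) → ℝ)) → Prop}
    (hP : ∀ U : (i : Fin k) → (Fin ((W i).N + 1) → ℝ),
      (∀ i, U i ≠ 0 ∧ NearSpace τ (U i) (bottomSpace (zetaDatum (W i)))) → P U)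
    {S D : Set Datum}
    (hS : {d | ∀ U : (i : Fin k) → (Fin ((W i).N + 1) → ℝ), (∀ i, IsBottomVector (d (W i)) (U i)) → P U} ∩
      arithDialSpace ⊆ S)
    (hD : arithDialSpace ⊆ D) : ¬ Separates S D zetaDatum :=
  not_separates_of_esToleranceClass_subset W hτ
    (fun _ hd => hS ⟨esToleranceClass_subset_forall_tuple hP hd.1, hd.2⟩) hD

/-- **PROVED — SHARING, binder-free**: either ¬RH with `ζ` detectably negative, or detectably negative ARITHMETIC
data inside `esToleranceClass ζ W τ` come `τ_unif`-arbitrarily close to `ζ`. [folklore] -/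
theorem esToleranceClass_shared_by_near_negatives {k : ℕ} (W : Fin k → Window) {τ : ℝ} (hτ : 0 < τ) :
    (¬ RiemannHypothesis ∧ DetectablyNegative zetaDatum) ∨
      ∀ ε : ℝ, 0 < ε → ∃ d ∈ arithDialSpace, d ≠ zetaDatum ∧ DetectablyNegative d ∧
        UniformlyClose ε zetaDatum d ∧ d ∈ esToleranceClass zetaDatum W τ := by
  refine tally_not_riemannHypothesis_or_negativesAccumulateNe.imp_right fun hacc ε hε => ?_
  obtain ⟨ε₀, hε₀, hrob⟩ := robustWithin_dialSpace_esToleranceClass_zeta W hτ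
  obtain ⟨d, hd, hne, hneg, hclose⟩ := hacc (min ε ε₀) (lt_min hε hε₀)
  exact ⟨d, hd, hne, hneg, hclose.of_le (min_le_left _ _),
    hrob d (arithDialSpace_subset_dialSpace hd) (hclose.of_le (min_le_right _ _))⟩

/-! ## §7 Bridges to the gen-3 binder: `HasBottomGap` ⟺ simple bottom; the classes agree at simple windows -/

/-- PROVED: under a bottom gap every bottom vector is a MULTIPLE of `u₀` (symmetric `M`). [folklore] -/
theorem eq_smul_of_hasBottomGap {n : ℕ} {M : Matrix (Fin n) (Fin n) ℝ} (hM : M.IsSymm) {u₀ : Fin n → ℝ}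
    {γ : ℝ} (hgap : HasBottomGap M u₀ γ) {u : Fin n → ℝ} (hu : IsBottomVector M u) : ∃ c : ℝ, u = c • u₀ :=
  eq_smul_of_sinSqLe_zero hgap.1.1 (sinSqLe_zero_of_hasBottomGap hM hgap hu)

/-- **PROVED — A SIMPLE BOTTOM HAS A GAP**: if `u₀` is a bottom vector of the symmetric `M` and every bottom vector
is a multiple of `u₀`, then `HasBottomGap M u₀ γ` for some `γ > 0` (the space gap of §2). So the gen-3 binder is
EXACTLY 'the bottom of `ζ`'s model matrix at this window is simple'. [folklore] -/
theorem hasBottomGap_of_simple {n : ℕ} {M : Matrix (Fin n) (Fin n) ℝ} (hM : M.IsSymm) {u₀ : Fin n → ℝ}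
    (hu₀ : IsBottomVector M u₀) (hsimple : ∀ u, IsBottomVector M u → ∃ c : ℝ, u = c • u₀) :
    ∃ γ : ℝ, HasBottomGap M u₀ γ := by
  obtain ⟨γ, hγ, hgap⟩ := exists_spaceGap_of_isSymm hM
  refine ⟨γ, hu₀, hγ, fun v hv => hgap v fun e he => ?_⟩
  by_cases he0 : e = 0
  · rw [he0, dotProduct_zero]
  · obtain ⟨c, rfl⟩ := hsimple e ⟨he0, he⟩
    rw [dotProduct_smul, smul_eq_mul, hv, mul_zero]

/-- PROVED: the characterisation `(∃ γ, HasBottomGap M u₀ γ) ↔ (u₀ bottom vector ∧ bottom simple)`. [folklore] -/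
theorem hasBottomGap_iff_simple {n : ℕ} {M : Matrix (Fin n) (Fin n) ℝ} (hM : M.IsSymm) {u₀ : Fin n → ℝ} :
    (∃ γ : ℝ, HasBottomGap M u₀ γ) ↔
      IsBottomVector M u₀ ∧ ∀ u, IsBottomVector M u → ∃ c : ℝ, u = c • u₀ :=
  ⟨fun ⟨_, hgap⟩ => ⟨hgap.1, fun _ hu => eq_smul_of_hasBottomGap hM hgap hu⟩,
    fun ⟨hu₀, hsimple⟩ => hasBottomGap_of_simple hM hu₀ hsimple⟩

/-- PROVED: with a simple bottom the bottom eigenspace is the LINE `ℝ u₀`. [folklore] -/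
theorem bottomSpace_eq_span_of_simple {n : ℕ} {M : Matrix (Fin n) (Fin n) ℝ} {u₀ : Fin n → ℝ}
    (hu₀ : IsBottomVector M u₀) (hsimple : ∀ u, IsBottomVector M u → ∃ c : ℝ, u = c • u₀) :
    bottomSpace M = Submodule.span ℝ {u₀} := by
  refine le_antisymm (fun u hu => ?_) (Submodule.span_le.2 (Set.singleton_subset_iff.2 hu₀.2))
  by_cases h0 : u = 0
  · rw [h0]
    exact Submodule.zero_mem _
  · obtain ⟨c, rfl⟩ := hsimple u ⟨h0, hu⟩
    exact Submodule.mem_span_singleton.2 ⟨c, rfl⟩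

/-- **PROVED — AT SIMPLE WINDOWS THE TWO CLASSES AGREE**: if at every window `W i` the reference's bottom is simple
with bottom vector `U₀ i`, then `esToleranceClass d₀ W τ = evToleranceClass W U₀ τ`. [folklore] -/
theorem esToleranceClass_eq_evToleranceClass {k : ℕ} {d₀ : Datum} {W : Fin k → Window}
    {U₀ : (i : Fin k) → (Fin ((W i).N + 1) → ℝ)} (hU₀ : ∀ i, IsBottomVector (d₀ (W i)) (U₀ i))
    (hsimple : ∀ i u, IsBottomVector (d₀ (W i)) u → ∃ c : ℝ, u = c • U₀ i) (τ : ℝ) :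
    esToleranceClass d₀ W τ = evToleranceClass W U₀ τ := by
  ext d
  simp only [esToleranceClass, evToleranceClass, mem_setOf_eq]
  refine forall_congr' fun i => and_congr Iff.rfl (forall_congr' fun u => imp_congr Iff.rfl ?_)
  rw [bottomSpace_eq_span_of_simple (hU₀ i) (hsimple i)]
  exact nearSpace_span_iff_sinSqLe (hU₀ i).1

/-- **PROVED — THE GEN-3 WALL WITH 'SIMPLE BOTTOM' IN PLACE OF THE CERTIFIED GAP.** If `ζ`'s bottom at each `W i`
is simple with bottom vector `U₀ i` (no `γ` named), every class containing the arithmetic part of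
`evToleranceClass W U₀ τ` (`τ > 0`) separates `ζ` from the negatives of no `D ⊇ arithDialSpace`. [folklore] -/
theorem not_separates_of_evToleranceClass_subset_of_simple {k : ℕ} {W : Fin k → Window}
    {U₀ : (i : Fin k) → (Fin ((W i).N + 1) → ℝ)} (hU₀ : ∀ i, IsBottomVector (zetaDatum (W i)) (U₀ i))
    (hsimple : ∀ i u, IsBottomVector (zetaDatum (W i)) u → ∃ c : ℝ, u = c • U₀ i) {τ : ℝ} (hτ : 0 < τ)
    {S D : Set Datum} (hS : evToleranceClass W U₀ τ ∩ arithDialSpace ⊆ S) (hD : arithDialSpace ⊆ D) :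
    ¬ Separates S D zetaDatum := by
  rw [← esToleranceClass_eq_evToleranceClass hU₀ hsimple τ] at hS
  exact not_separates_of_esToleranceClass_subset W hτ hS hD

end Summit.RiemannHypothesis.RiemannHypothesis.Theorems.PfPersistence

end
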